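import Literature.NumberTheory.Sieve.FGKMT2018YSquareSumBridge
import Literature.NumberTheory.Sieve.FGKMT2018MainTermPrefactor
import Literature.NumberTheory.LFunctions.MertensElementary
import HarnessLib

/-!
# Maynard 2016, Lemma 8.5 (i) — a crude, Lemma-8.4-free bound for `λ_max` (FGKMT weights, `𝒜 = ℤ`)

Topic `Literature/NumberTheory/Sieve`. Source: J. Maynard, *Dense clusters of primes in subsets*,
Compositio Math. 152 (2016) 1517–1554 [Maynard2016DenseClusters], Lemma 8.5 (i) p. 17
(`λ_max ≪ y_max log^k R`) with §7 p. 13 (the sets `𝒟_k(𝓛)`, `j_{p,1}, …, j_{p,ω(p)}`), Lemma 8.1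
p. 15; K. Ford, B. Green, S. Konyagin, J. Maynard, T. Tao, *Long gaps between primes*, JAMS 31
(2018) [FordGreenKonyaginMaynardTao2018], (7.5)–(7.9) p. 21.

For the weights `λ_d = μ(∏dᵢ) ∏dᵢ ∑_{r ∈ 𝒟_k(𝓛), dᵢ ∣ rᵢ} y_r/φ_ω(∏rᵢ)` of [FGKMT (7.5)–(7.9)]
(= [Maynard §7]) with Maynard's test function `F = F_k` we prove the polylogarithmic bound
`|λ_d| ≤ 2 (2e⁵ log R)^k` (`maynard_lamVar_F_abs_le`), WITHOUT Lemma 8.4 (which Maynard uses for the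
sharper `λ_max ≪ k⁴ y_max log^k R … ` of Lemma 8.5 (i)): the combinatorial heart is the exact
evaluation of the index-restricted divisor sums over `𝒟_k(𝓛)`,
`∏dᵢ · ∑_{r ∈ 𝒟_k, d ∣ r, p ∣ ∏r ⇒ p ∈ T} 1/φ_ω(∏rᵢ) ≤ ∏_{p ∈ T} p/(p − ω(p))`
(`prod_mul_sum_inv_phiOmega_le`; one prime at a time, the `ω(p)` admissible indices `j_{p,a}` of
[Maynard §7 p. 13] contribute `ω(p)/(p − ω(p))` each), after which
`y_max · 𝔖_{WB} (WB/φ(WB))^k ∏_{p ≤ R, p ∤ WB} p/(p − ω(p)) ≤ 2 (2e⁵ log R)^k` by the singular-series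
bounds of Lemma 8.1 (`singFactor_le_one_of_omegaL_eq`, tail over the `≤ log Δ/log R` exceptional
primes) and the elementary Mertens bound `∏_{p ≤ N}(1 − 1/p) ≥ e^{−5}/log N`
(`MertensBound.exp_neg_div_log_le_prod_one_sub_inv`). This crude `λ_max` is all that Lemma 8.5 (iii)
(`w_n ≪ R² λ_max² log^{2k} R = R^{2+o(1)}`) and the error terms of Props. 9.1–9.4 need.

## References
* J. Maynard, *Dense clusters of primes in subsets*, Compositio Math. 152 (2016), §7, Lemma 8.1,
  Lemma 8.5 [Maynard2016DenseClusters].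
* K. Ford, B. Green, S. Konyagin, J. Maynard, T. Tao, *Long gaps between primes*, JAMS 31 (2018),
  (7.5)–(7.9) [FordGreenKonyaginMaynardTao2018].
* G. H. Hardy, E. M. Wright, *An Introduction to the Theory of Numbers*, Thm 429 (Mertens)
  [HardyWright2008].
-/

noncomputable section

open Finset
open scoped ArithmeticFunction.Moebius

namespace Literature.NumberTheory.Sieve.FGKMT2018

variable {k : ℕ}

/-! ### Primes of `𝒟_k(𝓛)` and positivity of `φ_ω` -/

/-- A prime not dividing `WB` exceeds `2k²` (every `p ≤ 2k²` divides `W` or `B`).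
[cite: Maynard2016DenseClusters, §7 p. 13 (definition of W)] -/
theorem two_mul_sq_lt_of_not_dvd_wCut_mul {B p : ℕ} (hp : p.Prime) (hpW : ¬ p ∣ wCut k B * B) :
    2 * k ^ 2 < p :=
  lt_of_not_ge fun h => hpW (dvd_wCut_mul_of_le hp h)

/-- For admissible `𝓛` and a prime `p ∤ WB`: `ω(p) ≤ k ≤ 2k² < p`.
[cite: Maynard2016DenseClusters, §7 p. 13 («ω(p) < p», p > 2k²)] -/
theorem omegaL_lt_of_not_dvd_wCut_mul {L : Fin k → ℤ × ℤ} (hadm : FormsAdmissible L) {B p : ℕ}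
    (hp : p.Prime) (hpW : ¬ p ∣ wCut k B * B) : omegaL L p < p := by
  have h1 := two_mul_sq_lt_of_not_dvd_wCut_mul (k := k) hp hpW
  have h2 := omegaL_le_card_of_admissible hadm hp
  have h3 : k ≤ 2 * k ^ 2 := by nlinarith
  omega

/-- `φ_ω(N) > 0` when every prime of `N` has `ω(p) < p`.
[cite: FordGreenKonyaginMaynardTao2018, (7.8) p. 21] -/
theorem phiOmega_pos_of_forall_lt (L : Fin k → ℤ × ℤ) {N : ℕ}
    (h : ∀ p ∈ N.primeFactors, omegaL L p < p) : 0 < phiOmega L N := by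
  unfold phiOmega
  refine Finset.prod_pos fun p hp => ?_
  have := h p hp
  rw [sub_pos]; exact_mod_cast this

/-- `φ_ω(∏ rᵢ) > 0` for `r ∈ 𝒟_k(𝓛)` (admissible `𝓛`): the primes of `∏ rᵢ` are coprime to `WB`.
[cite: FordGreenKonyaginMaynardTao2018, (7.5), (7.8) p. 21] -/
theorem phiOmega_prod_pos_of_mem_dkBox {L : Fin k → ℤ × ℤ} (hadm : FormsAdmissible L) {B : ℕ}
    {R : ℝ} {r : Fin k → ℕ} (hr : r ∈ dkBox L B R) : 0 < phiOmega L (∏ i, r i) := by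
  refine phiOmega_pos_of_forall_lt L fun p hp => ?_
  have hpr := Nat.prime_of_mem_primeFactors hp
  have hc := Nat.Coprime.coprime_dvd_left (Nat.dvd_of_mem_primeFactors hp) (coprime_of_mem_dkBox hr)
  exact omegaL_lt_of_not_dvd_wCut_mul hadm hpr ((Nat.Prime.coprime_iff_not_dvd hpr).1 hc)

/-- A prime divides at most one coordinate of a vector with squarefree product:
`∑ⱼ 1_{p ∣ rⱼ} c = 1_{p ∣ ∏ rᵢ} c`. [cite: Maynard2016DenseClusters, §7 p. 13 («(d_i, d_j) = 1 for i ≠ j»)] -/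
theorem sum_ite_dvd_apply_eq {r : Fin k → ℕ} (hr : Squarefree (∏ i, r i)) {p : ℕ} (hp : p.Prime)
    (c : ℝ) : ∑ j, (if p ∣ r j then c else 0) = if p ∣ ∏ i, r i then c else 0 := by
  classical
  by_cases hpr : p ∣ ∏ i, r i
  · obtain ⟨j₀, -, hj₀⟩ := ((Nat.prime_iff.1 hp).dvd_finsetProd_iff _).1 hpr
    rw [if_pos hpr, ← Finset.sum_filter]
    have hset : Finset.univ.filter (fun j => p ∣ r j) = {j₀} := by
      ext i
      simp only [Finset.mem_filter, Finset.mem_univ, true_and, Finset.mem_singleton]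
      constructor
      · intro hpi
        by_contra hne
        have hg := Nat.dvd_gcd hpi hj₀
        rw [(coprime_apply_of_squarefree_prod hr hne).gcd_eq_one] at hg
        exact hp.one_lt.ne' (Nat.dvd_one.1 hg)
      · rintro rfl; exact hj₀
    rw [hset, Finset.sum_singleton]
  · rw [if_neg hpr]
    refine Finset.sum_eq_zero fun j _ => ?_
    rw [if_neg]
    exact fun hpj => hpr (hpj.trans (Finset.dvd_prod_of_mem r (Finset.mem_univ j)))

/-- Undoing the peeling map: `(r/p@j)·p@j = r` when `p ∣ rⱼ`. [cite: Maynard2016DenseClusters, proof of Prop. 9.1 p. 19, (9.5)] -/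
theorem update_div_update_mul (r : Fin k → ℕ) (j : Fin k) {p : ℕ} (hpj : p ∣ r j) :
    Function.update (Function.update r j (r j / p)) j
        (Function.update r j (r j / p) j * p) = r := by
  rw [Function.update_idem, Function.update_self, Nat.div_mul_cancel hpj, Function.update_eq_self]

/-! ### The index-restricted divisor sums over `𝒟_k(𝓛)` (Maynard §7 p. 13, Lemma 8.5 (i)) -/

/-- **Peeling one prime at an admissible index.** For a prime `p` with `ω(p) < p` and an index `j`:
the map `r ↦ r/p@j` sends `{r ∈ 𝒟_k : p ∣ rⱼ, primes of ∏r in T ∪ {p}}` injectively into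
`{r' ∈ 𝒟_k : primes of ∏r' in T}` and `1/φ_ω(∏r) = (p − ω(p))⁻¹ · 1/φ_ω(∏r')`, whence
`∑_{p ∣ rⱼ} 1/φ_ω(∏r) ≤ (p − ω(p))⁻¹ ∑_{T} 1/φ_ω(∏r')`.
[cite: Maynard2016DenseClusters, §7 p. 13 (the indices j_{p,a}), Lemma 8.5 (i) proof p. 17] -/
theorem sum_filter_dvd_apply_inv_phiOmega_le {L : Fin k → ℤ × ℤ} (B : ℕ) (R : ℝ)
    {T : Finset ℕ} (hT : ∀ q ∈ T, q.Prime ∧ omegaL L q < q) {p : ℕ} (hp : p.Prime)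
    (hωp : omegaL L p < p) (j : Fin k) :
    ∑ r ∈ ((dkBox L B R).filter (fun r => (∏ i, r i).primeFactors ⊆ insert p T)).filter
        (fun r => p ∣ r j), 1 / phiOmega L (∏ i, r i) ≤
      1 / ((p : ℝ) - omegaL L p) *
        ∑ r ∈ (dkBox L B R).filter (fun r => (∏ i, r i).primeFactors ⊆ T),
          1 / phiOmega L (∏ i, r i) := by
  classical
  set S' := ((dkBox L B R).filter (fun r => (∏ i, r i).primeFactors ⊆ insert p T)).filter
    (fun r => p ∣ r j) with hS'
  set S := (dkBox L B R).filter (fun r => (∏ i, r i).primeFactors ⊆ T) with hS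
  set ψ : (Fin k → ℕ) → (Fin k → ℕ) := fun r => Function.update r j (r j / p) with hψ
  have hpω : (0 : ℝ) < (p : ℝ) - omegaL L p := by rw [sub_pos]; exact_mod_cast hωp
  -- the summands peel
  have h1 : ∀ r ∈ S', 1 / phiOmega L (∏ i, r i) =
      1 / ((p : ℝ) - omegaL L p) * (1 / phiOmega L (∏ i, ψ r i)) := by
    intro r hr
    obtain ⟨hr1, hpj⟩ := Finset.mem_filter.1 hr
    obtain ⟨hrD, -⟩ := Finset.mem_filter.1 hr1
    have hsq := squarefree_of_mem_dkBox hrD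
    have hpr : p ∣ ∏ i, r i := hpj.trans (Finset.dvd_prod_of_mem r (Finset.mem_univ j))
    have hquot : (∏ i, ψ r i) = (∏ i, r i) / p :=
      (Nat.div_eq_of_eq_mul_right hp.pos (by rw [hψ, mul_prod_update_div r j hpj])).symm
    rw [hquot, phiOmega_eq_mul_div L hsq hp hpr, one_div_mul_one_div]
  rw [Finset.sum_congr rfl h1, ← Finset.mul_sum]
  refine mul_le_mul_of_nonneg_left ?_ (le_of_lt (one_div_pos.2 hpω))
  -- `ψ` is injective on `S'` and maps into `S`
  have hinj : Set.InjOn ψ S' := by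
    intro r₁ hr₁ r₂ hr₂ h
    have hp1 : p ∣ r₁ j := (Finset.mem_filter.1 (Finset.mem_coe.1 hr₁)).2
    have hp2 : p ∣ r₂ j := (Finset.mem_filter.1 (Finset.mem_coe.1 hr₂)).2
    rw [← update_div_update_mul r₁ j hp1, ← update_div_update_mul r₂ j hp2]
    show Function.update (ψ r₁) j (ψ r₁ j * p) = Function.update (ψ r₂) j (ψ r₂ j * p)
    rw [h]
  have hmaps : S'.image ψ ⊆ S := by
    intro r' hr'
    obtain ⟨r, hr, rfl⟩ := Finset.mem_image.1 hr'
    obtain ⟨hr1, hpj⟩ := Finset.mem_filter.1 hr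
    obtain ⟨hrD, hpf⟩ := Finset.mem_filter.1 hr1
    have hsq := squarefree_of_mem_dkBox hrD
    have hpr : p ∣ ∏ i, r i := hpj.trans (Finset.dvd_prod_of_mem r (Finset.mem_univ j))
    have hquot : (∏ i, ψ r i) = (∏ i, r i) / p :=
      (Nat.div_eq_of_eq_mul_right hp.pos (by rw [hψ, mul_prod_update_div r j hpj])).symm
    refine Finset.mem_filter.2 ⟨update_div_mem_dkBox hrD j hpj, ?_⟩
    rw [hquot, primeFactors_div_of_squarefree hsq hp hpr]
    intro q hq
    obtain ⟨hqp, hq'⟩ := Finset.mem_erase.1 hq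
    exact (Finset.mem_insert.1 (hpf hq')).resolve_left hqp
  have hnonneg : ∀ r ∈ S, r ∉ S'.image ψ → (0 : ℝ) ≤ 1 / phiOmega L (∏ i, r i) := by
    intro r hr _
    obtain ⟨-, hpf⟩ := Finset.mem_filter.1 hr
    exact le_of_lt (one_div_pos.2 (phiOmega_pos_of_forall_lt L fun q hq => (hT q (hpf hq)).2))
  calc ∑ r ∈ S', 1 / phiOmega L (∏ i, ψ r i)
      = ∑ r' ∈ S'.image ψ, 1 / phiOmega L (∏ i, r' i) :=
        (Finset.sum_image (f := fun r' : Fin k → ℕ => 1 / phiOmega L (∏ i, r' i)) hinj).symm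
    _ ≤ ∑ r ∈ S, 1 / phiOmega L (∏ i, r i) := Finset.sum_le_sum_of_subset_of_nonneg hmaps hnonneg

/-- **The local divisor-sum bound, `d = 1`.** For admissible `𝓛` and a finite set `T` of primes
with `ω(p) < p`:  `∑_{r ∈ 𝒟_k(𝓛), p ∣ ∏rᵢ ⇒ p ∈ T} 1/φ_ω(∏rᵢ) ≤ ∏_{p ∈ T} p/(p − ω(p))`
(induction on `T`: the vectors with `p ∣ ∏r` have `p ∣ rⱼ` for exactly one of the `ω(p)` admissible
indices `j = j_{p,a}`, [Maynard §7 p. 13], and peel to `T`; `1 + ω(p)/(p − ω(p)) = p/(p − ω(p))`).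
[cite: Maynard2016DenseClusters, §7 p. 13, Lemma 8.5 (i) proof p. 17 («λ_max ≪ y_max ∑ … ≪ y_max log^k R»)] -/
theorem sum_inv_phiOmega_le_prod {L : Fin k → ℤ × ℤ} (hadm : FormsAdmissible L) (B : ℕ) (R : ℝ)
    (T : Finset ℕ) (hT : ∀ q ∈ T, q.Prime ∧ omegaL L q < q) :
    ∑ r ∈ (dkBox L B R).filter (fun r => (∏ i, r i).primeFactors ⊆ T),
        1 / phiOmega L (∏ i, r i) ≤ ∏ p ∈ T, (p : ℝ) / ((p : ℝ) - omegaL L p) := by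
  classical
  induction T using Finset.induction_on with
  | empty =>
    have hsub : (dkBox L B R).filter (fun r => (∏ i, r i).primeFactors ⊆ (∅ : Finset ℕ)) ⊆
        {fun _ => 1} := by
      intro r hr
      obtain ⟨hrD, hpf⟩ := Finset.mem_filter.1 hr
      have hr1 : ∀ i, 1 ≤ r i := one_le_of_mem_dkBox hrD
      have hP1 : (∏ i, r i) = 1 := by
        have h0 : (∏ i, r i) ≠ 0 := (Finset.prod_pos fun i _ => hr1 i).ne'
        rcases Nat.primeFactors_eq_empty.1 (Finset.subset_empty.1 hpf) with h | h
        · exact (h0 h).elim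
        · exact h
      rw [Finset.mem_singleton]
      exact funext fun i => Nat.dvd_one.1 (by
        rw [← hP1]; exact Finset.dvd_prod_of_mem r (Finset.mem_univ i))
    have hone : 1 / phiOmega L (∏ i, (fun _ : Fin k => (1 : ℕ)) i) = 1 := by
      rw [Finset.prod_const_one]
      unfold phiOmega
      rw [Nat.primeFactors_one, Finset.prod_empty, div_one]
    calc ∑ r ∈ (dkBox L B R).filter (fun r => (∏ i, r i).primeFactors ⊆ (∅ : Finset ℕ)),
          1 / phiOmega L (∏ i, r i)
        ≤ ∑ r ∈ ({fun _ => 1} : Finset (Fin k → ℕ)), 1 / phiOmega L (∏ i, r i) :=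
          Finset.sum_le_sum_of_subset_of_nonneg hsub (by
            intro r hr _
            rw [Finset.mem_singleton] at hr
            rw [hr, hone]; exact zero_le_one)
      _ = 1 := by rw [Finset.sum_singleton, hone]
      _ = ∏ p ∈ (∅ : Finset ℕ), (p : ℝ) / ((p : ℝ) - omegaL L p) := (Finset.prod_empty).symm
  | insert p T hpT ih =>
    have hT' : ∀ q ∈ T, q.Prime ∧ omegaL L q < q := fun q hq => hT q (Finset.mem_insert_of_mem hq)
    have hp : p.Prime := (hT p (Finset.mem_insert_self p T)).1
    have hωp : omegaL L p < p := (hT p (Finset.mem_insert_self p T)).2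
    have hpω : (0 : ℝ) < (p : ℝ) - omegaL L p := by rw [sub_pos]; exact_mod_cast hωp
    have IH := ih hT'
    set S' := (dkBox L B R).filter (fun r => (∏ i, r i).primeFactors ⊆ insert p T) with hS'
    set S := (dkBox L B R).filter (fun r => (∏ i, r i).primeFactors ⊆ T) with hS
    set f : (Fin k → ℕ) → ℝ := fun r => 1 / phiOmega L (∏ i, r i) with hf
    have hS0 : 0 ≤ ∑ r ∈ S, f r := by
      refine Finset.sum_nonneg fun r hr => ?_
      obtain ⟨-, hpf⟩ := Finset.mem_filter.1 hr
      exact le_of_lt (one_div_pos.2 (phiOmega_pos_of_forall_lt L fun q hq => (hT' q (hpf hq)).2))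
    -- (1) the part `p ∤ ∏r` lies in `S`
    have hA : ∑ r ∈ S'.filter (fun r => ¬ p ∣ ∏ i, r i), f r ≤ ∑ r ∈ S, f r := by
      refine Finset.sum_le_sum_of_subset_of_nonneg ?_ ?_
      · intro r hr
        obtain ⟨hr1, hpr⟩ := Finset.mem_filter.1 hr
        obtain ⟨hrD, hpf⟩ := Finset.mem_filter.1 hr1
        refine Finset.mem_filter.2 ⟨hrD, fun q hq => ?_⟩
        have hqp : q ≠ p := fun h => hpr (h ▸ Nat.dvd_of_mem_primeFactors hq)
        exact (Finset.mem_insert.1 (hpf hq)).resolve_left hqp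
      · intro r hr _
        obtain ⟨-, hpf⟩ := Finset.mem_filter.1 hr
        exact le_of_lt (one_div_pos.2 (phiOmega_pos_of_forall_lt L fun q hq => (hT' q (hpf hq)).2))
    -- (2) the part `p ∣ ∏r` splits over the coordinate `j` with `p ∣ rⱼ`
    have hB : ∑ r ∈ S'.filter (fun r => p ∣ ∏ i, r i), f r =
        ∑ j ∈ (Finset.univ : Finset (Fin k)), ∑ r ∈ S'.filter (fun r => p ∣ r j), f r := by
      rw [Finset.sum_filter]
      have h1 : ∀ r ∈ S', (if p ∣ ∏ i, r i then f r else 0) =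
          ∑ j ∈ (Finset.univ : Finset (Fin k)), (if p ∣ r j then f r else 0) := by
        intro r hr
        obtain ⟨hrD, -⟩ := Finset.mem_filter.1 hr
        exact (sum_ite_dvd_apply_eq (squarefree_of_mem_dkBox hrD) hp (f r)).symm
      rw [Finset.sum_congr rfl h1, Finset.sum_comm]
      exact Finset.sum_congr rfl fun j _ => (Finset.sum_filter _ _).symm
    -- (3) only admissible indices occur
    have hzero : ∀ j ∈ (Finset.univ : Finset (Fin k)), j ∉ admIdx L p →
        ∑ r ∈ S'.filter (fun r => p ∣ r j), f r = 0 := by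
      intro j _ hj
      refine Finset.sum_eq_zero fun r hr => ?_
      obtain ⟨hr1, hpj⟩ := Finset.mem_filter.1 hr
      obtain ⟨hrD, -⟩ := Finset.mem_filter.1 hr1
      exact (hj (mem_admIdx.2 (exists_root_of_mem_dkBox hrD j
        (Nat.mem_primeFactors.2 ⟨hp, hpj,
          Nat.one_le_iff_ne_zero.1 (one_le_of_mem_dkBox hrD j)⟩)))).elim
    -- (4) each admissible index contributes at most `(p − ω(p))⁻¹ ∑_S f`
    have hC : ∑ j ∈ (Finset.univ : Finset (Fin k)), ∑ r ∈ S'.filter (fun r => p ∣ r j), f r ≤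
        (omegaL L p : ℝ) * (1 / ((p : ℝ) - omegaL L p) * ∑ r ∈ S, f r) := by
      rw [← Finset.sum_subset (Finset.subset_univ (admIdx L p)) hzero]
      calc ∑ j ∈ admIdx L p, ∑ r ∈ S'.filter (fun r => p ∣ r j), f r
          ≤ ∑ j ∈ admIdx L p, (1 / ((p : ℝ) - omegaL L p) * ∑ r ∈ S, f r) :=
            Finset.sum_le_sum fun j _ => sum_filter_dvd_apply_inv_phiOmega_le B R hT' hp hωp j
        _ = (omegaL L p : ℝ) * (1 / ((p : ℝ) - omegaL L p) * ∑ r ∈ S, f r) := by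
            rw [Finset.sum_const, nsmul_eq_mul, card_admIdx hadm hp]
    -- assemble
    rw [← Finset.sum_filter_add_sum_filter_not S' (fun r => p ∣ ∏ i, r i), Finset.prod_insert hpT]
    calc ∑ r ∈ S'.filter (fun r => p ∣ ∏ i, r i), f r + ∑ r ∈ S'.filter (fun r => ¬ p ∣ ∏ i, r i), f r
        ≤ (omegaL L p : ℝ) * (1 / ((p : ℝ) - omegaL L p) * ∑ r ∈ S, f r) + ∑ r ∈ S, f r :=
          add_le_add (hB ▸ hC) hA
      _ = (p : ℝ) / ((p : ℝ) - omegaL L p) * ∑ r ∈ S, f r := by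
          field_simp
          ring
      _ ≤ (p : ℝ) / ((p : ℝ) - omegaL L p) * ∏ q ∈ T, (q : ℝ) / ((q : ℝ) - omegaL L q) :=
          mul_le_mul_of_nonneg_left IH (div_nonneg (Nat.cast_nonneg _) hpω.le)

/-- `φ_ω` is multiplicative on coprime arguments. [cite: FordGreenKonyaginMaynardTao2018, (7.8) p. 21 (φ_ω multiplicative)] -/
theorem phiOmega_mul_of_coprime (L : Fin k → ℤ × ℤ) {a b : ℕ} (hab : a.Coprime b) :
    phiOmega L (a * b) = phiOmega L a * phiOmega L b := by
  unfold phiOmega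
  rw [Nat.Coprime.primeFactors_mul hab, Finset.prod_union (Nat.Coprime.disjoint_primeFactors hab)]

/-- `δ/φ_ω(δ) = ∏_{p ∣ δ} p/(p − ω(p))` for squarefree `δ`.
[cite: Maynard2016DenseClusters, Lemma 8.5 (i) proof p. 17 («d/φ_ω(d)»)] -/
theorem cast_div_phiOmega_eq (L : Fin k → ℤ × ℤ) {δ : ℕ} (hδ : Squarefree δ) :
    (δ : ℝ) / phiOmega L δ = ∏ p ∈ δ.primeFactors, (p : ℝ) / ((p : ℝ) - omegaL L p) := by
  unfold phiOmega
  rw [Finset.prod_div_distrib]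
  congr 1
  have h := congrArg (Nat.cast : ℕ → ℝ) (Nat.prod_primeFactors_of_squarefree hδ)
  push_cast at h
  exact h.symm

/-- **The local divisor-sum bound** [Maynard, Lemma 8.5 (i)]: for admissible `𝓛`, a finite set `T`
of primes with `ω(p) < p` and ANY `d`,
`∏dᵢ · ∑_{r ∈ 𝒟_k(𝓛), dᵢ ∣ rᵢ, p ∣ ∏rᵢ ⇒ p ∈ T} 1/φ_ω(∏rᵢ) ≤ ∏_{p ∈ T} p/(p − ω(p))`
(substitute `r = d·r'`: `∏d/φ_ω(∏d) = ∏_{p ∣ ∏d} p/(p − ω(p))` and `r'` avoids the primes of `∏d`).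
This replaces Maynard's appeal to Lemma 8.4 in the estimation of `λ_max` by an exact local count.
[cite: Maynard2016DenseClusters, Lemma 8.5 (i) proof p. 17, §7 p. 13] -/
theorem prod_mul_sum_inv_phiOmega_le {L : Fin k → ℤ × ℤ} (hadm : FormsAdmissible L) (B : ℕ)
    (R : ℝ) {T : Finset ℕ} (hT : ∀ q ∈ T, q.Prime ∧ omegaL L q < q) (d : Fin k → ℕ) :
    (∏ i, (d i : ℝ)) * ∑ r ∈ (dkBox L B R).filter
        (fun r => (∀ i, d i ∣ r i) ∧ (∏ i, r i).primeFactors ⊆ T), 1 / phiOmega L (∏ i, r i) ≤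
      ∏ p ∈ T, (p : ℝ) / ((p : ℝ) - omegaL L p) := by
  classical
  set Sd := (dkBox L B R).filter
    (fun r => (∀ i, d i ∣ r i) ∧ (∏ i, r i).primeFactors ⊆ T) with hSd
  have hprod0 : ∀ U : Finset ℕ, (∀ q ∈ U, q.Prime ∧ omegaL L q < q) →
      0 ≤ ∏ p ∈ U, (p : ℝ) / ((p : ℝ) - omegaL L p) := by
    intro U hU
    refine Finset.prod_nonneg fun p hp => div_nonneg (Nat.cast_nonneg _) ?_
    rw [sub_nonneg]; exact_mod_cast (hU p hp).2.le
  rcases Sd.eq_empty_or_nonempty with h0 | ⟨r₀, hr₀⟩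
  · rw [h0, Finset.sum_empty, mul_zero]; exact hprod0 T hT
  obtain ⟨hr₀D, hdr₀, hpf₀⟩ := Finset.mem_filter.1 hr₀
  have hd : d ∈ dkBox L B R := mem_dkBox_of_dvd hr₀D hdr₀
  have hd1 : ∀ i, 1 ≤ d i := one_le_of_mem_dkBox hd
  set δ := ∏ i, d i with hδ
  have hδsq : Squarefree δ := squarefree_of_mem_dkBox hd
  have hδT : δ.primeFactors ⊆ T := by
    refine subset_trans (Nat.primeFactors_mono
      (Finset.prod_dvd_prod_of_dvd _ _ fun i _ => hdr₀ i) ?_) hpf₀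
    exact (Finset.prod_pos fun i _ => one_le_of_mem_dkBox hr₀D i).ne'
  set T' := T \ δ.primeFactors with hT'def
  have hT' : ∀ q ∈ T', q.Prime ∧ omegaL L q < q := fun q hq => hT q (Finset.mem_sdiff.1 hq).1
  have hφδ : 0 < phiOmega L δ := phiOmega_pos_of_forall_lt L fun q hq => (hT q (hδT hq)).2
  -- the substitution `r = d · r'`
  set ψ : (Fin k → ℕ) → (Fin k → ℕ) := fun r i => r i / d i with hψ
  have hmul : ∀ r ∈ Sd, (∏ i, r i) = δ * ∏ i, ψ r i := by
    intro r hr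
    obtain ⟨-, hdr, -⟩ := Finset.mem_filter.1 hr
    rw [hδ, ← Finset.prod_mul_distrib]
    exact Finset.prod_congr rfl fun i _ => (Nat.mul_div_cancel' (hdr i)).symm
  have hcop : ∀ r ∈ Sd, δ.Coprime (∏ i, ψ r i) := by
    intro r hr
    have hsq := squarefree_of_mem_dkBox (Finset.mem_filter.1 hr).1
    rw [hmul r hr] at hsq
    exact (Nat.squarefree_mul_iff.1 hsq).1
  have key : ∑ r ∈ Sd, 1 / phiOmega L (∏ i, r i) ≤
      1 / phiOmega L δ * ∑ r' ∈ (dkBox L B R).filter (fun r => (∏ i, r i).primeFactors ⊆ T'),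
        1 / phiOmega L (∏ i, r' i) := by
    have h1 : ∀ r ∈ Sd, 1 / phiOmega L (∏ i, r i) =
        1 / phiOmega L δ * (1 / phiOmega L (∏ i, ψ r i)) := by
      intro r hr
      rw [hmul r hr, phiOmega_mul_of_coprime L (hcop r hr), one_div_mul_one_div]
    rw [Finset.sum_congr rfl h1, ← Finset.mul_sum]
    refine mul_le_mul_of_nonneg_left ?_ (le_of_lt (one_div_pos.2 hφδ))
    have hinj : Set.InjOn ψ Sd := by
      intro r₁ hr₁ r₂ hr₂ h
      have hd₁ : ∀ i, d i ∣ r₁ i := (Finset.mem_filter.1 (Finset.mem_coe.1 hr₁)).2.1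
      have hd₂ : ∀ i, d i ∣ r₂ i := (Finset.mem_filter.1 (Finset.mem_coe.1 hr₂)).2.1
      funext i
      have hi : r₁ i / d i = r₂ i / d i := congrFun h i
      rw [← Nat.mul_div_cancel' (hd₁ i), hi, Nat.mul_div_cancel' (hd₂ i)]
    have hmaps : Sd.image ψ ⊆ (dkBox L B R).filter (fun r => (∏ i, r i).primeFactors ⊆ T') := by
      intro r' hr'
      obtain ⟨r, hr, rfl⟩ := Finset.mem_image.1 hr'
      obtain ⟨hrD, hdr, hpf⟩ := Finset.mem_filter.1 hr
      refine Finset.mem_filter.2 ⟨mem_dkBox_of_dvd hrD fun i => Nat.div_dvd_of_dvd (hdr i), ?_⟩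
      intro q hq
      have hne : δ * ∏ i, ψ r i ≠ 0 := by
        rw [← hmul r hr]; exact (Finset.prod_pos fun i _ => one_le_of_mem_dkBox hrD i).ne'
      have hq' : q ∈ (∏ i, r i).primeFactors := by
        rw [hmul r hr]
        exact Nat.primeFactors_mono (Dvd.intro_left _ rfl) hne hq
      refine Finset.mem_sdiff.2 ⟨hpf hq', fun hqδ => ?_⟩
      exact Finset.disjoint_left.1 (Nat.Coprime.disjoint_primeFactors (hcop r hr)) hqδ hq
    have hnonneg : ∀ r ∈ (dkBox L B R).filter (fun r => (∏ i, r i).primeFactors ⊆ T'),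
        r ∉ Sd.image ψ → (0 : ℝ) ≤ 1 / phiOmega L (∏ i, r i) := by
      intro r hr _
      obtain ⟨-, hpf⟩ := Finset.mem_filter.1 hr
      exact le_of_lt (one_div_pos.2 (phiOmega_pos_of_forall_lt L fun q hq => (hT' q (hpf hq)).2))
    calc ∑ r ∈ Sd, 1 / phiOmega L (∏ i, ψ r i)
        = ∑ r' ∈ Sd.image ψ, 1 / phiOmega L (∏ i, r' i) :=
          (Finset.sum_image (f := fun r' : Fin k → ℕ => 1 / phiOmega L (∏ i, r' i)) hinj).symm
      _ ≤ _ := Finset.sum_le_sum_of_subset_of_nonneg hmaps hnonneg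
  have hcast : (∏ i, (d i : ℝ)) = (δ : ℝ) := by rw [hδ, Nat.cast_prod]
  calc (∏ i, (d i : ℝ)) * ∑ r ∈ Sd, 1 / phiOmega L (∏ i, r i)
      ≤ (δ : ℝ) * (1 / phiOmega L δ * ∑ r' ∈ (dkBox L B R).filter
          (fun r => (∏ i, r i).primeFactors ⊆ T'), 1 / phiOmega L (∏ i, r' i)) := by
        rw [hcast]; exact mul_le_mul_of_nonneg_left key (Nat.cast_nonneg _)
    _ = (δ : ℝ) / phiOmega L δ * ∑ r' ∈ (dkBox L B R).filter
          (fun r => (∏ i, r i).primeFactors ⊆ T'), 1 / phiOmega L (∏ i, r' i) := by ring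
    _ ≤ (δ : ℝ) / phiOmega L δ * ∏ p ∈ T', (p : ℝ) / ((p : ℝ) - omegaL L p) :=
        mul_le_mul_of_nonneg_left (sum_inv_phiOmega_le_prod hadm B R T' hT')
          (div_nonneg (Nat.cast_nonneg _) hφδ.le)
    _ = ∏ p ∈ T, (p : ℝ) / ((p : ℝ) - omegaL L p) := by
        rw [cast_div_phiOmega_eq L hδsq, mul_comm, hT'def, Finset.prod_sdiff hδT]

/-! ### `λ_max ≤ y_max · ∏_{p ≤ R, p ∤ WB} p/(p − ω(p))` (Maynard, Lemma 8.5 (i), first display) -/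

/-- The primes `p ≤ N` with `p ∤ WB` (the index set of `𝔖_{WB}(𝓛; N)`) satisfy `ω(p) < p`.
[cite: Maynard2016DenseClusters, §7 p. 13] -/
theorem prime_and_omegaL_lt_of_mem_filter {L : Fin k → ℤ × ℤ} (hadm : FormsAdmissible L) (B N : ℕ) :
    ∀ q ∈ (Finset.range (N + 1)).filter (fun p => p.Prime ∧ ¬ p ∣ wCut k B * B),
      q.Prime ∧ omegaL L q < q := by
  intro q hq
  obtain ⟨-, hqp, hqW⟩ := Finset.mem_filter.1 hq
  exact ⟨hqp, omegaL_lt_of_not_dvd_wCut_mul hadm hqp hqW⟩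

/-- **Lemma 8.5 (i), local form** [Maynard]: for `k ≥ 2`, admissible non-degenerate `𝓛`, `B ≠ 0`,
`R > 1`, the weights built from `F = F_k` satisfy, for every `d`,
`|λ_d| ≤ y_max · ∏_{p ≤ ⌊R⌋, p ∤ WB} p/(p − ω(p))`, `y_max = (WB)^k/φ(WB)^k · 𝔖_{WB}(𝓛)`
(`0 ≤ F_k ≤ 1`, `y_r = 0` unless `∏rᵢ < R`, and `prod_mul_sum_inv_phiOmega_le` with
`T = {p ≤ ⌊R⌋ : p ∤ WB}`). [cite: Maynard2016DenseClusters, Lemma 8.5 (i) p. 17 («λ_max ≪ y_max ∑_{…} …»)] -/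
theorem abs_lamVar_F_le_pref_mul_prod (hk : 2 ≤ k) {L : Fin k → ℤ × ℤ} (hadm : FormsAdmissible L)
    (hnd : FormsNondegenerate L) {B : ℕ} (hB : B ≠ 0) {R : ℝ} (hR : 1 < R) (d : Fin k → ℕ) :
    |lamVar L B R (MaynardDense.F k) d| ≤
      ((wCut k B * B : ℕ) : ℝ) ^ k / (Nat.totient (wCut k B * B) : ℝ) ^ k *
          singSeriesExcl L (wCut k B * B) *
        ∏ p ∈ (Finset.range (⌊R⌋₊ + 1)).filter (fun p => p.Prime ∧ ¬ p ∣ wCut k B * B),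
          (p : ℝ) / ((p : ℝ) - omegaL L p) := by
  classical
  set P := ((wCut k B * B : ℕ) : ℝ) ^ k / (Nat.totient (wCut k B * B) : ℝ) ^ k *
    singSeriesExcl L (wCut k B * B) with hPdef
  set T := (Finset.range (⌊R⌋₊ + 1)).filter (fun p => p.Prime ∧ ¬ p ∣ wCut k B * B) with hTdef
  have hT : ∀ q ∈ T, q.Prime ∧ omegaL L q < q := prime_and_omegaL_lt_of_mem_filter hadm B ⌊R⌋₊
  have hP : 0 < P := yPref_pos hadm hnd (by omega) hB
  set Sd := (dkBox L B R).filter (fun r => ∀ i, d i ∣ r i) with hSd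
  have hφpos : ∀ r ∈ Sd, 0 < phiOmega L (∏ i, r i) := fun r hr =>
    phiOmega_prod_pos_of_mem_dkBox hadm (Finset.mem_filter.1 hr).1
  have hd0 : 0 ≤ ∏ i, (d i : ℝ) := Finset.prod_nonneg fun i _ => Nat.cast_nonneg _
  -- Step 1: `|λ_d| ≤ ∏dᵢ · ∑_{d ∣ r} |y_r|/φ_ω(∏rᵢ)`
  have h1 : |lamVar L B R (MaynardDense.F k) d| ≤
      (∏ i, (d i : ℝ)) * ∑ r ∈ Sd, |yVar L B R (MaynardDense.F k) r| / phiOmega L (∏ i, r i) := by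
    unfold lamVar
    rw [abs_mul, abs_mul, abs_of_nonneg hd0]
    have hμ : |((μ (∏ i, d i) : ℤ) : ℝ)| ≤ 1 := by
      exact_mod_cast ArithmeticFunction.abs_moebius_le_one
    have hsum : |∑ r ∈ Sd, yVar L B R (MaynardDense.F k) r / phiOmega L (∏ i, r i)| ≤
        ∑ r ∈ Sd, |yVar L B R (MaynardDense.F k) r| / phiOmega L (∏ i, r i) := by
      refine (Finset.abs_sum_le_sum_abs _ _).trans (le_of_eq (Finset.sum_congr rfl fun r hr => ?_))
      rw [abs_div, abs_of_pos (hφpos r hr)]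
    have hs0 : 0 ≤ ∑ r ∈ Sd, |yVar L B R (MaynardDense.F k) r| / phiOmega L (∏ i, r i) :=
      Finset.sum_nonneg fun r hr => div_nonneg (abs_nonneg _) (hφpos r hr).le
    calc |((μ (∏ i, d i) : ℤ) : ℝ)| * (∏ i, (d i : ℝ)) *
          |∑ r ∈ Sd, yVar L B R (MaynardDense.F k) r / phiOmega L (∏ i, r i)|
        ≤ 1 * (∏ i, (d i : ℝ)) *
            ∑ r ∈ Sd, |yVar L B R (MaynardDense.F k) r| / phiOmega L (∏ i, r i) :=
          mul_le_mul (mul_le_mul_of_nonneg_right hμ hd0) hsum (abs_nonneg _) (by positivity)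
      _ = _ := by rw [one_mul]
  -- Step 2: `|y_r| ≤ P`, `y_r = 0` unless `∏rᵢ < R`, and then the primes of `∏rᵢ` lie in `T`
  have h2 : ∑ r ∈ Sd, |yVar L B R (MaynardDense.F k) r| / phiOmega L (∏ i, r i) ≤
      P * ∑ r ∈ (dkBox L B R).filter
        (fun r => (∀ i, d i ∣ r i) ∧ (∏ i, r i).primeFactors ⊆ T), 1 / phiOmega L (∏ i, r i) := by
    have hvan : ∀ r ∈ Sd, |yVar L B R (MaynardDense.F k) r| / phiOmega L (∏ i, r i) ≠ 0 →
        (∏ i, r i).primeFactors ⊆ T := by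
      intro r hr hne
      obtain ⟨hrD, -⟩ := Finset.mem_filter.1 hr
      have hr1 := one_le_of_mem_dkBox hrD
      have hlt : (∏ i, (r i : ℝ)) < R := by
        by_contra hge
        exact hne (by rw [yVar_F_eq_zero_of_le_prod L B hR r hr1 (not_lt.1 hge), abs_zero, zero_div])
      intro q hq
      have hqp := Nat.prime_of_mem_primeFactors hq
      have hqdvd := Nat.dvd_of_mem_primeFactors hq
      have hP0 : 0 < ∏ i, r i := Finset.prod_pos fun i _ => hr1 i
      have hqle : q ≤ ⌊R⌋₊ := by
        refine (Nat.le_of_dvd hP0 hqdvd).trans (Nat.le_floor ?_)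
        rw [Nat.cast_prod]; exact hlt.le
      refine Finset.mem_filter.2 ⟨Finset.mem_range.2 (Nat.lt_succ_of_le hqle), hqp, ?_⟩
      exact (Nat.Prime.coprime_iff_not_dvd hqp).1
        (Nat.Coprime.coprime_dvd_left hqdvd (coprime_of_mem_dkBox hrD))
    rw [← Finset.sum_filter_of_ne hvan]
    have hset : Sd.filter (fun r => (∏ i, r i).primeFactors ⊆ T) =
        (dkBox L B R).filter (fun r => (∀ i, d i ∣ r i) ∧ (∏ i, r i).primeFactors ⊆ T) := by
      rw [hSd, Finset.filter_filter]
    rw [hset, Finset.mul_sum]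
    refine Finset.sum_le_sum fun r hr => ?_
    obtain ⟨hrD, -, -⟩ := Finset.mem_filter.1 hr
    have hφ := phiOmega_prod_pos_of_mem_dkBox hadm hrD
    rw [mul_one_div]
    exact div_le_div_of_nonneg_right ((abs_yVar_F_le hk L B hR.le r (one_le_of_mem_dkBox hrD)).trans
      (le_of_eq (abs_of_pos hP))) hφ.le
  -- Step 3: the local divisor-sum bound
  calc |lamVar L B R (MaynardDense.F k) d|
      ≤ (∏ i, (d i : ℝ)) * (P * ∑ r ∈ (dkBox L B R).filter
          (fun r => (∀ i, d i ∣ r i) ∧ (∏ i, r i).primeFactors ⊆ T), 1 / phiOmega L (∏ i, r i)) :=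
        h1.trans (mul_le_mul_of_nonneg_left h2 hd0)
    _ = P * ((∏ i, (d i : ℝ)) * ∑ r ∈ (dkBox L B R).filter
          (fun r => (∀ i, d i ∣ r i) ∧ (∏ i, r i).primeFactors ⊆ T), 1 / phiOmega L (∏ i, r i)) := by
        ring
    _ ≤ P * ∏ p ∈ T, (p : ℝ) / ((p : ℝ) - omegaL L p) :=
        mul_le_mul_of_nonneg_left (prod_mul_sum_inv_phiOmega_le hadm B R hT d) hP.le

/-! ### The tail of `𝔖_{WB}(𝓛)` beyond `N` (Maynard, Lemma 8.1) -/

/-- `(1 − ω(p)/p)(1 − 1/p)^{-k} ≤ (1 − 1/p)^{-k}` (`0 ≤ ω(p) ≤ p`).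
[cite: Maynard2016DenseClusters, Lemma 8.1 p. 15] -/
theorem singFactor_le_inv_pow (L : Fin k → ℤ × ℤ) {p : ℕ} (hp : 2 ≤ p) :
    singFactor L p ≤ (1 - 1 / (p : ℝ))⁻¹ ^ k := by
  unfold singFactor
  have hp0 : (0 : ℝ) < p := by exact_mod_cast (by omega : 0 < p)
  have h1 : 1 - (omegaL L p : ℝ) / p ≤ 1 := by
    have : (0 : ℝ) ≤ (omegaL L p : ℝ) / p := by positivity
    linarith
  have hq : 0 ≤ (1 - 1 / (p : ℝ))⁻¹ ^ k := by
    refine pow_nonneg (inv_nonneg.2 ?_) _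
    rw [sub_nonneg, div_le_one hp0]; exact_mod_cast (by omega : 1 ≤ p)
  exact mul_le_of_le_one_left hq h1

/-- For `p ≥ N + 1`, `N ≥ 1`: `(1 − 1/p)^{-k} ≤ (1 − 1/(N+1))^{-k}`. [folklore] -/
private theorem inv_one_sub_pow_le {N p : ℕ} (hN : 1 ≤ N) (hp : N + 1 ≤ p) :
    (1 - 1 / (p : ℝ))⁻¹ ^ k ≤ (1 - 1 / ((N : ℝ) + 1))⁻¹ ^ k := by
  have hN1 : (0 : ℝ) < (N : ℝ) + 1 := by positivity
  have hp' : (N : ℝ) + 1 ≤ p := by exact_mod_cast hp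
  have hθ : 0 < 1 - 1 / ((N : ℝ) + 1) := by
    rw [sub_pos, div_lt_one hN1]
    have : (1 : ℝ) ≤ N := by exact_mod_cast hN
    linarith
  have hle : 1 - 1 / ((N : ℝ) + 1) ≤ 1 - 1 / (p : ℝ) := by
    have := one_div_le_one_div_of_le hN1 hp'
    linarith
  exact pow_le_pow_left₀ (inv_nonneg.2 (hθ.le.trans hle)) (inv_anti₀ hθ hle) k

/-- `θ = (1 − 1/(N+1))^{-k} ≥ 1`. [folklore] -/
private theorem one_le_inv_one_sub_pow {N : ℕ} (hN : 1 ≤ N) : (1 : ℝ) ≤ (1 - 1 / ((N : ℝ) + 1))⁻¹ ^ k := by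
  refine one_le_pow₀ (one_le_inv_iff₀.2 ⟨?_, ?_⟩)
  · rw [sub_pos, div_lt_one (by positivity)]
    have : (1 : ℝ) ≤ N := by exact_mod_cast hN
    linarith
  · have : (0 : ℝ) ≤ 1 / ((N : ℝ) + 1) := by positivity
    linarith

/-- **Tail of the partial products** [Maynard, Lemma 8.1]: for admissible `𝓛`, `N ≥ 1` and all `m`,
`𝔖_D(𝓛; N+m) ≤ 𝔖_D(𝓛; N) · θ^{#{N < p ≤ N+m prime : ω(p) ≠ k}}`, `θ = (1 − 1/(N+1))^{-k}`:
the Euler factors with `ω(p) = k` are `≤ 1` (`singFactor_le_one_of_omegaL_eq`), the others `≤ θ`.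
[cite: Maynard2016DenseClusters, Lemma 8.1 p. 15 («the product over p > … is 1 + O(k²/p²)…»)] -/
theorem singPartial_add_le {L : Fin k → ℤ × ℤ} (hadm : FormsAdmissible L) (D : ℕ) {N : ℕ}
    (hN : 1 ≤ N) (m : ℕ) :
    singPartial L D (N + m) ≤ singPartial L D N *
      ((1 - 1 / ((N : ℝ) + 1))⁻¹ ^ k) ^
        #((Finset.Ioc N (N + m)).filter (fun p => p.Prime ∧ omegaL L p ≠ k)) := by
  set θ := (1 - 1 / ((N : ℝ) + 1))⁻¹ ^ k with hθ
  have hθ1 : 1 ≤ θ := one_le_inv_one_sub_pow hN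
  have hS0 : 0 ≤ singPartial L D N := (singPartial_pos_of_admissible hadm D N).le
  have hωlt : ∀ p : ℕ, p.Prime → omegaL L p < p := ((formsAdmissible_iff_omegaL L).mp hadm).2
  induction m with
  | zero =>
    rw [Nat.add_zero, Finset.Ioc_self, Finset.filter_empty, Finset.card_empty, pow_zero, mul_one]
  | succ m ih =>
    have hmono : #((Finset.Ioc N (N + m)).filter (fun p => p.Prime ∧ omegaL L p ≠ k)) ≤
        #((Finset.Ioc N (N + m + 1)).filter (fun p => p.Prime ∧ omegaL L p ≠ k)) :=
      Finset.card_le_card (Finset.filter_subset_filter _ (Finset.Ioc_subset_Ioc_right (by omega)))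
    rw [show N + (m + 1) = N + m + 1 from (Nat.add_assoc N m 1).symm, singPartial_succ]
    split_ifs with hcase
    · obtain ⟨hp, -⟩ := hcase
      by_cases hω : omegaL L (N + m + 1) = k
      · calc singPartial L D (N + m) * singFactor L (N + m + 1)
            ≤ singPartial L D (N + m) * 1 :=
              mul_le_mul_of_nonneg_left (singFactor_le_one_of_omegaL_eq L (by omega) hω)
                (singPartial_pos_of_admissible hadm D _).le
          _ ≤ singPartial L D N * θ ^
                #((Finset.Ioc N (N + m)).filter (fun p => p.Prime ∧ omegaL L p ≠ k)) := by
              rw [mul_one]; exact ih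
          _ ≤ singPartial L D N * θ ^
                #((Finset.Ioc N (N + m + 1)).filter (fun p => p.Prime ∧ omegaL L p ≠ k)) :=
              mul_le_mul_of_nonneg_left (pow_le_pow_right₀ hθ1 hmono) hS0
      · have hmem : N + m + 1 ∈ (Finset.Ioc N (N + m + 1)).filter
            (fun p => p.Prime ∧ omegaL L p ≠ k) :=
          Finset.mem_filter.2 ⟨Finset.mem_Ioc.2 ⟨by omega, le_rfl⟩, hp, hω⟩
        have hnot : N + m + 1 ∉ (Finset.Ioc N (N + m)).filter
            (fun p => p.Prime ∧ omegaL L p ≠ k) := fun h => by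
          have := (Finset.mem_Ioc.1 (Finset.mem_filter.1 h).1).2; omega
        have hcard : #((Finset.Ioc N (N + m)).filter (fun p => p.Prime ∧ omegaL L p ≠ k)) + 1 ≤
            #((Finset.Ioc N (N + m + 1)).filter (fun p => p.Prime ∧ omegaL L p ≠ k)) := by
          rw [← Finset.card_insert_of_notMem hnot]
          exact Finset.card_le_card (Finset.insert_subset hmem
            (Finset.filter_subset_filter _ (Finset.Ioc_subset_Ioc_right (by omega))))
        have hsf : singFactor L (N + m + 1) ≤ θ :=
          (singFactor_le_inv_pow L (by omega)).trans (inv_one_sub_pow_le hN (by omega))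
        have hsf0 : 0 ≤ singFactor L (N + m + 1) :=
          (singFactor_pos_of_omegaL_lt L (by omega) (hωlt _ hp)).le
        calc singPartial L D (N + m) * singFactor L (N + m + 1)
            ≤ singPartial L D N * θ ^
                #((Finset.Ioc N (N + m)).filter (fun p => p.Prime ∧ omegaL L p ≠ k)) * θ :=
              mul_le_mul ih hsf hsf0 (mul_nonneg hS0 (pow_nonneg (zero_le_one.trans hθ1) _))
          _ = singPartial L D N * θ ^
                (#((Finset.Ioc N (N + m)).filter (fun p => p.Prime ∧ omegaL L p ≠ k)) + 1) := by
              ring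
          _ ≤ singPartial L D N * θ ^
                #((Finset.Ioc N (N + m + 1)).filter (fun p => p.Prime ∧ omegaL L p ≠ k)) :=
              mul_le_mul_of_nonneg_left (pow_le_pow_right₀ hθ1 hcard) hS0
    · rw [mul_one]
      exact ih.trans (mul_le_mul_of_nonneg_left (pow_le_pow_right₀ hθ1 hmono) hS0)

/-- **`𝔖_D(𝓛) ≤ 2 𝔖_D(𝓛; N)`** when the exceptional primes beyond `N` are few: if every prime
`p ∤ E` has `ω(p) = k` (`E ≥ 1`, e.g. `E = ∏|aᵢ| ∏_{i≠j}|aᵢbⱼ − aⱼbᵢ|`) and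
`2k · #{p ∣ E : p > N} ≤ N + 1` (`N ≥ 2k`, `N ≥ 1`), then the tail of the Euler product is at most
`(1 − 1/(N+1))^{-k·#{…}} ≤ 2`. [cite: Maynard2016DenseClusters, Lemma 8.1 p. 15 (tail of 𝔖_B)] -/
theorem singSeriesExcl_le_two_mul_singPartial {L : Fin k → ℤ × ℤ} (hadm : FormsAdmissible L)
    (D : ℕ) {N : ℕ} (hN : 1 ≤ N) (hkN : 2 * k ≤ N) {E : ℕ} (hE1 : 1 ≤ E)
    (hE : ∀ p : ℕ, p.Prime → ¬ p ∣ E → omegaL L p = k)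
    (hsmall : 2 * k * #(E.primeFactors.filter (fun p => N < p)) ≤ N + 1) :
    singSeriesExcl L D ≤ 2 * singPartial L D N := by
  set b := #(E.primeFactors.filter (fun p => N < p)) with hb
  set θ := (1 - 1 / ((N : ℝ) + 1))⁻¹ ^ k with hθ
  have hθ1 : 1 ≤ θ := one_le_inv_one_sub_pow hN
  have hS0 : 0 ≤ singPartial L D N := (singPartial_pos_of_admissible hadm D N).le
  have hP : ∀ p : ℕ, p.Prime → N + E < p → omegaL L p = k := fun p hp hlt =>
    hE p hp fun hdvd => absurd (Nat.le_of_dvd (by omega) hdvd) (by omega)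
  have h1 := (singSeriesExcl_bounds_of_forall_omegaL_eq hadm (P₀ := N + E) (by omega) (by omega)
    hP D).2.2
  have h2 := singPartial_add_le hadm D hN E
  have hcb : #((Finset.Ioc N (N + E)).filter (fun p => p.Prime ∧ omegaL L p ≠ k)) ≤ b := by
    refine Finset.card_le_card fun p hp => ?_
    obtain ⟨hpI, hpp, hω⟩ := Finset.mem_filter.1 hp
    refine Finset.mem_filter.2 ⟨Nat.mem_primeFactors.2 ⟨hpp, ?_, by omega⟩, (Finset.mem_Ioc.1 hpI).1⟩
    by_contra hnd
    exact hω (hE p hpp hnd)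
  have hθb : θ ^ b ≤ 2 := by
    have hN1 : (0 : ℝ) < (N : ℝ) + 1 := by positivity
    set t := 1 / ((N : ℝ) + 1) with ht
    have ht0 : 0 ≤ t := by positivity
    have ht1 : t ≤ 1 / 2 :=
      one_div_le_one_div_of_le (by norm_num) (by
        have : (1 : ℝ) ≤ N := by exact_mod_cast hN
        linarith)
    have hbern : 1 - ((k * b : ℕ) : ℝ) * t ≤ (1 - t) ^ (k * b) := by
      have h := one_add_mul_le_pow (a := -t) (by linarith) (k * b)
      calc 1 - ((k * b : ℕ) : ℝ) * t = 1 + (k * b : ℕ) * (-t) := by ring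
        _ ≤ (1 + -t) ^ (k * b) := h
        _ = (1 - t) ^ (k * b) := by ring
    have hhalf : (1 : ℝ) / 2 ≤ 1 - ((k * b : ℕ) : ℝ) * t := by
      have hkb : ((k * b : ℕ) : ℝ) * t ≤ 1 / 2 := by
        rw [ht, ← mul_div_assoc, mul_one, div_le_iff₀ hN1]
        have : ((2 * k * b : ℕ) : ℝ) ≤ ((N + 1 : ℕ) : ℝ) := by exact_mod_cast hsmall
        push_cast at this ⊢
        linarith
      linarith
    have hpos : 0 < (1 - t) ^ (k * b) := pow_pos (by linarith) _
    rw [hθ, ← pow_mul, inv_pow, ← one_div]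
    calc 1 / (1 - t) ^ (k * b) ≤ 1 / (1 / 2) :=
          one_div_le_one_div_of_le (by norm_num) (hhalf.trans hbern)
      _ = 2 := by norm_num
  calc singSeriesExcl L D ≤ singPartial L D (N + E) := h1
    _ ≤ singPartial L D N * θ ^
          #((Finset.Ioc N (N + E)).filter (fun p => p.Prime ∧ omegaL L p ≠ k)) := h2
    _ ≤ singPartial L D N * θ ^ b := mul_le_mul_of_nonneg_left (pow_le_pow_right₀ hθ1 hcb) hS0
    _ ≤ singPartial L D N * 2 := mul_le_mul_of_nonneg_left hθb hS0
    _ = 2 * singPartial L D N := mul_comm _ _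

/-! ### Mertens assembly: `y_max · ∏_{p ≤ N, p ∤ WB} p/(p − ω(p)) ≤ 2 (2e⁵ log N)^k` -/

/-- `B/φ(B) ≤ 2` for `B = 1` or `B` prime.
[cite: FordGreenKonyaginMaynardTao2018, §8 p. 23 («Since B is either 1 or prime, φ(B)/B ≍ 1»)] -/
theorem cast_div_totient_le_two {B : ℕ} (hB : B = 1 ∨ B.Prime) :
    (B : ℝ) / (Nat.totient B : ℝ) ≤ 2 := by
  rcases hB with rfl | hp
  · simp
  · rw [Nat.totient_prime hp]
    have h2 : 2 ≤ B := hp.two_le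
    have hcast : ((B - 1 : ℕ) : ℝ) = (B : ℝ) - 1 := by
      rw [Nat.cast_sub (by omega), Nat.cast_one]
    rw [hcast, div_le_iff₀ (by
      have : (2 : ℝ) ≤ B := by exact_mod_cast h2
      linarith)]
    have : (2 : ℝ) ≤ B := by exact_mod_cast h2
    linarith

/-- `W/φ(W) = ∏_{p ∣ W} (1 − 1/p)^{-1}` (Euler's product `φ(n) = n ∏_{p ∣ n}(1 − 1/p)`) for the
cut-off modulus `W`. [cite: HardyWright2008, Thm 62 (φ(n) = n∏(1 − 1/p))] -/
theorem cast_wCut_div_totient_eq (k B : ℕ) :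
    ((wCut k B : ℕ) : ℝ) / (Nat.totient (wCut k B) : ℝ) =
      ∏ p ∈ (wCut k B).primeFactors, (1 - 1 / (p : ℝ))⁻¹ := by
  have hW : ((wCut k B : ℕ) : ℝ) ≠ 0 := by exact_mod_cast wCut_ne_zero k B
  have hP : ∏ p ∈ (wCut k B).primeFactors, (1 - 1 / (p : ℝ)) ≠ 0 := by
    refine Finset.prod_ne_zero_iff.2 fun p hp => ?_
    have hp2 : (2 : ℝ) ≤ p := by exact_mod_cast (Nat.prime_of_mem_primeFactors hp).two_le
    have : 1 / (p : ℝ) < 1 := by rw [div_lt_one (by linarith)]; linarith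
    linarith
  rw [Literature.NumberTheory.LFunctions.MertensBound.totient_eq_mul_prod_one_sub_inv,
    ← div_div, div_self hW, one_div, Finset.prod_inv_distrib]

/-- `𝔖_{WB}(𝓛; N) · ∏_{p ≤ N, p ∤ WB} p/(p − ω(p)) = ∏_{p ≤ N, p ∤ WB} (1 − 1/p)^{-k}`.
[cite: Maynard2016DenseClusters, Lemma 8.5 (i) proof p. 17] -/
theorem singPartial_mul_prod_eq {L : Fin k → ℤ × ℤ} (hadm : FormsAdmissible L) (B N : ℕ) :
    singPartial L (wCut k B * B) N *
        ∏ p ∈ (Finset.range (N + 1)).filter (fun p => p.Prime ∧ ¬ p ∣ wCut k B * B),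
          (p : ℝ) / ((p : ℝ) - omegaL L p) =
      ∏ p ∈ (Finset.range (N + 1)).filter (fun p => p.Prime ∧ ¬ p ∣ wCut k B * B),
        (1 - 1 / (p : ℝ))⁻¹ ^ k := by
  unfold singPartial
  rw [← Finset.prod_mul_distrib]
  refine Finset.prod_congr rfl fun p hp => ?_
  obtain ⟨hpp, hω⟩ := prime_and_omegaL_lt_of_mem_filter hadm B N p hp
  have hp0 : (p : ℝ) ≠ 0 := by exact_mod_cast hpp.ne_zero
  have hpω : (p : ℝ) - omegaL L p ≠ 0 := by
    have : (omegaL L p : ℝ) < p := by exact_mod_cast hω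
    linarith
  unfold singFactor
  have h1 : (1 - (omegaL L p : ℝ) / p) * ((p : ℝ) / ((p : ℝ) - omegaL L p)) = 1 := by
    rw [one_sub_div hp0, div_mul_div_comm, mul_comm ((p : ℝ) - omegaL L p) (p : ℝ),
      div_self (mul_ne_zero hp0 hpω)]
  calc (1 - (omegaL L p : ℝ) / p) * (1 - 1 / (p : ℝ))⁻¹ ^ k * ((p : ℝ) / ((p : ℝ) - omegaL L p))
      = (1 - (omegaL L p : ℝ) / p) * ((p : ℝ) / ((p : ℝ) - omegaL L p)) *
          (1 - 1 / (p : ℝ))⁻¹ ^ k := by ring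
    _ = (1 - 1 / (p : ℝ))⁻¹ ^ k := by rw [h1, one_mul]

/-- A prime divisor of `W = ∏_{p ≤ 2k², p ∤ B} p` is `≤ 2k²`.
[cite: FordGreenKonyaginMaynardTao2018, §7 p. 21] -/
theorem le_two_mul_sq_of_dvd_wCut {B s : ℕ} (hs : s.Prime) (h : s ∣ wCut k B) : s ≤ 2 * k ^ 2 := by
  unfold wCut at h
  obtain ⟨p, hp, hsp⟩ := (Nat.Prime.prime hs).exists_mem_finset_dvd h
  rw [Finset.mem_filter, Finset.mem_range] at hp
  have := (Nat.prime_dvd_prime_iff_eq hs hp.2.1).mp hsp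
  omega

/-- The primes of `W` and the primes `p ≤ N`, `p ∤ WB` are disjoint subsets of the primes `≤ N`
(`2k² ≤ N`), so `∏_{p ∣ W}(1 − 1/p)^{-k} · ∏_{p ≤ N, p ∤ WB}(1 − 1/p)^{-k} ≤ ∏_{p ≤ N}(1 − 1/p)^{-k}`.
[folklore] -/
private theorem prod_primeFactors_mul_prod_filter_le {B N : ℕ} (hkN : 2 * k ^ 2 ≤ N) :
    (∏ p ∈ (wCut k B).primeFactors, (1 - 1 / (p : ℝ))⁻¹ ^ k) *
        ∏ p ∈ (Finset.range (N + 1)).filter (fun p => p.Prime ∧ ¬ p ∣ wCut k B * B),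
          (1 - 1 / (p : ℝ))⁻¹ ^ k ≤
      ∏ p ∈ Nat.primesLE N, (1 - 1 / (p : ℝ))⁻¹ ^ k := by
  have hdisj : Disjoint (wCut k B).primeFactors
      ((Finset.range (N + 1)).filter (fun p => p.Prime ∧ ¬ p ∣ wCut k B * B)) :=
    Finset.disjoint_left.2 fun p hpW hpT =>
      (Finset.mem_filter.1 hpT).2.2 (dvd_mul_of_dvd_left (Nat.dvd_of_mem_primeFactors hpW) B)
  have hsub : (wCut k B).primeFactors ∪
      (Finset.range (N + 1)).filter (fun p => p.Prime ∧ ¬ p ∣ wCut k B * B) ⊆ Nat.primesLE N := by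
    refine Finset.union_subset (fun p hp => ?_) (fun p hp => ?_)
    · have hpp := Nat.prime_of_mem_primeFactors hp
      refine Nat.mem_primesLE.2 ⟨?_, hpp⟩
      exact (le_two_mul_sq_of_dvd_wCut hpp (Nat.dvd_of_mem_primeFactors hp)).trans hkN
    · obtain ⟨hpr, hpp, -⟩ := Finset.mem_filter.1 hp
      exact Nat.mem_primesLE.2 ⟨by simpa [Finset.mem_range, Nat.lt_succ_iff] using hpr, hpp⟩
  have h1 : ∀ p ∈ Nat.primesLE N, (1 : ℝ) ≤ (1 - 1 / (p : ℝ))⁻¹ ^ k := by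
    intro p hp
    have hp2 : (2 : ℝ) ≤ p := by exact_mod_cast (Nat.mem_primesLE.1 hp).2.two_le
    refine one_le_pow₀ (one_le_inv_iff₀.2 ⟨?_, ?_⟩)
    · have : 1 / (p : ℝ) < 1 := by rw [div_lt_one (by linarith)]; linarith
      linarith
    · have : (0 : ℝ) ≤ 1 / (p : ℝ) := by positivity
      linarith
  rw [← Finset.prod_union hdisj]
  exact Finset.prod_le_prod_of_subset_of_one_le hsub
    (fun p hp => zero_le_one.trans (h1 p (hsub hp))) fun p hp _ => h1 p hp

/-- **Mertens** (from `MertensBound.exp_neg_div_log_le_prod_one_sub_inv`):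
`∏_{p ≤ N} (1 − 1/p)^{-k} ≤ (e⁵ log N)^k` for `N ≥ 2`.
[cite: RosserSchoenfeld1962, Thm 7 p. 70 (Mertens' product; here with the crude constant e⁵)] -/
theorem prod_primesLE_inv_pow_le {N : ℕ} (hN : 2 ≤ N) :
    ∏ p ∈ Nat.primesLE N, (1 - 1 / (p : ℝ))⁻¹ ^ k ≤ (Real.exp 5 * Real.log N) ^ k := by
  rw [Finset.prod_pow, Finset.prod_inv_distrib]
  have h := Literature.NumberTheory.LFunctions.MertensBound.exp_neg_div_log_le_prod_one_sub_inv N hN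
  have hlog : 0 < Real.log N := Real.log_pos (by exact_mod_cast (by omega : 1 < N))
  have hpos : 0 < Real.exp (-5) / Real.log N := div_pos (Real.exp_pos _) hlog
  refine pow_le_pow_left₀ (inv_nonneg.2 (hpos.le.trans h)) ?_ k
  calc (∏ p ∈ Nat.primesLE N, (1 - 1 / (p : ℝ)))⁻¹ ≤ (Real.exp (-5) / Real.log N)⁻¹ :=
        inv_anti₀ hpos h
    _ = Real.exp 5 * Real.log N := by
        rw [inv_div, Real.exp_neg, div_inv_eq_mul, mul_comm]

/-- **Lemma 8.5 (i) — the prefactor** [Maynard]: for admissible non-degenerate `𝓛`,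
`B = 1` or prime, `N ≥ 2k²`, `N ≥ 2`, and a modulus `E ≥ 1` such that `ω(p) = k` for all `p ∤ E`
with `2k · #{p ∣ E : p > N} ≤ N + 1`,
`y_max · ∏_{p ≤ N, p ∤ WB} p/(p − ω(p)) ≤ 2 · (2e⁵ log N)^k`, `y_max = (WB)^k/φ(WB)^k 𝔖_{WB}(𝓛)`
(`B/φ(B) ≤ 2`, `𝔖_{WB} ≤ 2𝔖_{WB}(N)`, `𝔖_{WB}(N)∏ p/(p−ω) = ∏_{p≤N,p∤WB}(1−1/p)^{-k}`, Mertens).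
[cite: Maynard2016DenseClusters, Lemma 8.5 (i) p. 17 («λ_max ≪ y_max (log R)^k»), Lemma 8.1 p. 15] -/
theorem pref_mul_prod_le {L : Fin k → ℤ × ℤ} (hadm : FormsAdmissible L) (hnd : FormsNondegenerate L)
    {B : ℕ} (hB : B = 1 ∨ B.Prime) {N : ℕ} (hN : 2 ≤ N) (hkN : 2 * k ^ 2 ≤ N) {E : ℕ} (hE1 : 1 ≤ E)
    (hE : ∀ p : ℕ, p.Prime → ¬ p ∣ E → omegaL L p = k)
    (hsmall : 2 * k * #(E.primeFactors.filter (fun p => N < p)) ≤ N + 1) :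
    ((wCut k B * B : ℕ) : ℝ) ^ k / (Nat.totient (wCut k B * B) : ℝ) ^ k *
          singSeriesExcl L (wCut k B * B) *
        ∏ p ∈ (Finset.range (N + 1)).filter (fun p => p.Prime ∧ ¬ p ∣ wCut k B * B),
          (p : ℝ) / ((p : ℝ) - omegaL L p) ≤
      2 * (2 * Real.exp 5 * Real.log N) ^ k := by
  have hkk : k ≤ k ^ 2 := Nat.le_self_pow two_ne_zero k
  have h2k : 2 * k ≤ N := by omega
  set T := (Finset.range (N + 1)).filter (fun p => p.Prime ∧ ¬ p ∣ wCut k B * B) with hTdef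
  have hT : ∀ q ∈ T, q.Prime ∧ omegaL L q < q := prime_and_omegaL_lt_of_mem_filter hadm B N
  have hT0 : 0 ≤ ∏ p ∈ T, (p : ℝ) / ((p : ℝ) - omegaL L p) := by
    refine Finset.prod_nonneg fun p hp => div_nonneg (Nat.cast_nonneg _) ?_
    rw [sub_nonneg]; exact_mod_cast (hT p hp).2.le
  have hS : singSeriesExcl L (wCut k B * B) ≤ 2 * singPartial L (wCut k B * B) N :=
    singSeriesExcl_le_two_mul_singPartial hadm (wCut k B * B) (by omega) h2k hE1 hE hsmall
  have hS0 : 0 ≤ singSeriesExcl L (wCut k B * B) :=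
    (singSeriesExcl_pos_of_nondegenerate hadm hnd _).le
  have hA0 : 0 ≤ ((wCut k B : ℕ) : ℝ) / (Nat.totient (wCut k B) : ℝ) := by positivity
  have hBφ : ((B : ℝ) / (Nat.totient B : ℝ)) ^ k ≤ 2 ^ k :=
    pow_le_pow_left₀ (by positivity) (cast_div_totient_le_two hB) k
  have hpref : ((wCut k B * B : ℕ) : ℝ) ^ k / (Nat.totient (wCut k B * B) : ℝ) ^ k =
      (((wCut k B : ℕ) : ℝ) / (Nat.totient (wCut k B) : ℝ)) ^ k *
        ((B : ℝ) / (Nat.totient B : ℝ)) ^ k := by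
    rw [← div_pow, cast_mul_div_totient_mul (coprime_wCut_self k B), mul_pow]
  have hWφ : (((wCut k B : ℕ) : ℝ) / (Nat.totient (wCut k B) : ℝ)) ^ k =
      ∏ p ∈ (wCut k B).primeFactors, (1 - 1 / (p : ℝ))⁻¹ ^ k := by
    rw [cast_wCut_div_totient_eq, Finset.prod_pow]
  rw [hpref]
  calc (((wCut k B : ℕ) : ℝ) / (Nat.totient (wCut k B) : ℝ)) ^ k *
          ((B : ℝ) / (Nat.totient B : ℝ)) ^ k * singSeriesExcl L (wCut k B * B) *
        ∏ p ∈ T, (p : ℝ) / ((p : ℝ) - omegaL L p)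
      ≤ (((wCut k B : ℕ) : ℝ) / (Nat.totient (wCut k B) : ℝ)) ^ k * 2 ^ k *
          (2 * singPartial L (wCut k B * B) N) * ∏ p ∈ T, (p : ℝ) / ((p : ℝ) - omegaL L p) := by
        refine mul_le_mul_of_nonneg_right ?_ hT0
        exact mul_le_mul (mul_le_mul_of_nonneg_left hBφ (pow_nonneg hA0 k)) hS hS0 (by positivity)
    _ = 2 ^ (k + 1) * ((((wCut k B : ℕ) : ℝ) / (Nat.totient (wCut k B) : ℝ)) ^ k *
          (singPartial L (wCut k B * B) N * ∏ p ∈ T, (p : ℝ) / ((p : ℝ) - omegaL L p))) := by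
        ring
    _ = 2 ^ (k + 1) * ((∏ p ∈ (wCut k B).primeFactors, (1 - 1 / (p : ℝ))⁻¹ ^ k) *
          ∏ p ∈ T, (1 - 1 / (p : ℝ))⁻¹ ^ k) := by
        rw [hWφ, hTdef, singPartial_mul_prod_eq hadm B N]
    _ ≤ 2 ^ (k + 1) * ∏ p ∈ Nat.primesLE N, (1 - 1 / (p : ℝ))⁻¹ ^ k :=
        mul_le_mul_of_nonneg_left (prod_primeFactors_mul_prod_filter_le hkN) (by positivity)
    _ ≤ 2 ^ (k + 1) * (Real.exp 5 * Real.log N) ^ k :=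
        mul_le_mul_of_nonneg_left (prod_primesLE_inv_pow_le hN) (by positivity)
    _ = 2 * (2 * Real.exp 5 * Real.log N) ^ k := by rw [pow_succ, mul_pow]; ring

/-- **Maynard 2016, Lemma 8.5 (i) (crude form, no Lemma 8.4)**: let `k ≥ 2`, `𝓛` admissible and
non-degenerate, `B = 1` or prime, `N = ⌊R⌋ ≥ max(2, 2k²)`, and let `E ≥ 1` be a modulus with
`ω(p) = k` for every prime `p ∤ E` (e.g. `E = ∏ᵢ|aᵢ| · ∏_{i≠j}|aᵢbⱼ − aⱼbᵢ|`) having few prime factors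
beyond `N`: `2k · #{p ∣ E : p > N} ≤ N + 1`. Then the weights (7.9) built from Maynard's `F = F_k`
satisfy, for EVERY `d`,
`|λ_d| ≤ 2 · (2e⁵ · log R)^k`.
(Maynard: `λ_max ≪ y_max log^k R` via Lemma 8.4; here `y_max ∏_{p ≤ R, p ∤ WB} p/(p − ω(p))` is
evaluated through the singular series instead, `abs_lamVar_F_le_pref_mul_prod` + `pref_mul_prod_le`.)
[cite: Maynard2016DenseClusters, Lemma 8.5 (i) p. 17; FordGreenKonyaginMaynardTao2018, (7.9) p. 21] -/
theorem maynard_lamVar_F_abs_le (hk : 2 ≤ k) {L : Fin k → ℤ × ℤ} (hadm : FormsAdmissible L)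
    (hnd : FormsNondegenerate L) {B : ℕ} (hB : B = 1 ∨ B.Prime) {R : ℝ} (hN : 2 ≤ ⌊R⌋₊)
    (hkN : 2 * k ^ 2 ≤ ⌊R⌋₊) {E : ℕ} (hE1 : 1 ≤ E)
    (hE : ∀ p : ℕ, p.Prime → ¬ p ∣ E → omegaL L p = k)
    (hsmall : 2 * k * #(E.primeFactors.filter (fun p => ⌊R⌋₊ < p)) ≤ ⌊R⌋₊ + 1) (d : Fin k → ℕ) :
    |lamVar L B R (MaynardDense.F k) d| ≤ 2 * (2 * Real.exp 5 * Real.log R) ^ k := by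
  have hR : (2 : ℝ) ≤ R := by
    by_contra h
    have := (Nat.floor_lt' (two_ne_zero)).2 (not_le.1 h)
    omega
  have hB0 : B ≠ 0 := by
    rcases hB with rfl | hp
    · exact one_ne_zero
    · exact hp.ne_zero
  have hfl : (1 : ℝ) ≤ (⌊R⌋₊ : ℝ) := by exact_mod_cast (by omega : 1 ≤ ⌊R⌋₊)
  have hlog : Real.log (⌊R⌋₊ : ℝ) ≤ Real.log R :=
    Real.log_le_log (by linarith) (Nat.floor_le (by linarith))
  have hlog0 : 0 ≤ Real.log (⌊R⌋₊ : ℝ) := Real.log_nonneg hfl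
  calc |lamVar L B R (MaynardDense.F k) d|
      ≤ ((wCut k B * B : ℕ) : ℝ) ^ k / (Nat.totient (wCut k B * B) : ℝ) ^ k *
            singSeriesExcl L (wCut k B * B) *
          ∏ p ∈ (Finset.range (⌊R⌋₊ + 1)).filter (fun p => p.Prime ∧ ¬ p ∣ wCut k B * B),
            (p : ℝ) / ((p : ℝ) - omegaL L p) :=
        abs_lamVar_F_le_pref_mul_prod hk hadm hnd hB0 (by linarith) d
    _ ≤ 2 * (2 * Real.exp 5 * Real.log (⌊R⌋₊ : ℝ)) ^ k :=
        pref_mul_prod_le hadm hnd hB hN hkN hE1 hE hsmall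
    _ ≤ 2 * (2 * Real.exp 5 * Real.log R) ^ k := by
        refine mul_le_mul_of_nonneg_left (pow_le_pow_left₀ (by positivity) ?_ k) (by norm_num)
        exact mul_le_mul_of_nonneg_left hlog (by positivity)

end Literature.NumberTheory.Sieve.FGKMT2018
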